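import Summits.BirchSwinnertonDyer.BirchSwinnertonDyer.Theses.ResidualThetaTransportAtTwo
import Summits.BirchSwinnertonDyer.BirchSwinnertonDyer.Theorems.ResidualThetaTransportAtTwoResidualThetaMainConjectureAtTwoAnalyticLayerLawAtTwo
import Summits.BirchSwinnertonDyer.BirchSwinnertonDyer.Theorems.ResidualThetaTransportAtTwoResidualThetaMainConjectureAtTwoAnalyticLayerLawKAtTwo
import Summits.BirchSwinnertonDyer.BirchSwinnertonDyer.Theorems.ResidualThetaTransportAtTwoResidualThetaMainConjectureAtTwoPollackCongruencesKAtTwo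
import Summits.BirchSwinnertonDyer.BirchSwinnertonDyer.Theorems.ResidualThetaTransportAtTwoResidualThetaMainConjectureAtTwoNormLambdaWitnessAtTwo
import Summits.BirchSwinnertonDyer.BirchSwinnertonDyer.Theorems.ResidualThetaTransportAtTwoResidualThetaMainConjectureAtTwoNonvanishingKAtTwo
import Summits.BirchSwinnertonDyer.BirchSwinnertonDyer.Theorems.ResidualThetaTransportAtTwoCohomologicalPlusPeriodSupplyPeriods
import Literature.NumberTheory.EllipticCurves.MatsunoLocalTermAtTwoReductionTypeProofs
import Literature.NumberTheory.EllipticCurves.GreenbergVatsal2000.ResidualSelmerGroups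
import Summits.BirchSwinnertonDyer.Rank1Residual.X2.EulerFactorInvariants
import HarnessLib

/-!
# Crux Kλ⁺ `ResidualThetaMainConjectureAtTwo` (stmt-BirchSwinnertonDyer-20787, route `ResidualThetaTransportAtTwo`):
# ONLY THE LOWER residual theta count is new — the upper half of the child crux `ResidualThetaCountAtTwo`
# (stmt-BirchSwinnertonDyer-24195) is Kato (K3) ∧ the analytic layer congruence (Kan⁺), both route items

Cell `bsd-wall`, seat `bsd-wall-rtt-p2` g5 (LEAD PROVER, line `birth`; `--supports` the crux). THEOREMS ONLY — no `def`,
no named fact, no `sorry`; every research input is an explicit hypothesis (a route decl BY NAME or a spelled-out statement);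
nothing about any curve is asserted and BSD is not proved by this.

Line `birth` v10/v11 reads Kλ⁺ ⟸ (RLF) `ResidualLambdaFormulaNegDiscAtTwo` (item 23110) ∧ (RMC) `ResidualThetaCountAtTwo` (item
24195), the residual theta count `#R⁺_{S₀}(W[2]) = 2^(d + Σ_{S₀} 2^{n_ℓ} d_{g,ℓ} + c)` (composition p587229). This file halves the
research content of that reading. Write (RMC) = (RMC≤) ∧ (RMC≥). In the frame of Kλ⁺ (newform `f` of `W`, `ϖ`, a Pollack pair
of `f` at `2`, `G` with `ι G = 2^m ϖ ι L⁺_W` all bound):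
* (RMC≤) is NOT new: by (RLF) at `W` the count is `2^(λ(X⁺_W) + Σ_W + c)`; Kato's divisibility (K3, route item
  `SignedKatoDivisibilityUpToAtTwo` BY NAME: `Char X⁺ = (g₁)`, `g₁·h = 2^{m'} ϖ L⁺`) gives `λ(X⁺_W) ≤ λ(G)`
  (`lambdaInvariant_le_lam_of_signedKato`), and the analytic layer congruence (Kan⁺, route item
  `ThetaLayerLambdaCongruenceAtTwo` BY NAME) read through the two LANDED layer laws (W-side p569313, partner side over `𝓞`
  p578766, at a cohomological period p576010/p576487 with the landed `𝓞`-Pollack pair p582559/p584035/p582561) gives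
  `λ(G) + Σ_W = d + Σ_g` (`lam_add_sum_eq_of_thetaLayerCongruence`); hence `λ(X⁺_W) + Σ_W ≤ d + Σ_g`.
* (RMC≥) `2^(d + Σ_{S₀} 2^{n_ℓ} d_{g,ℓ} + c) ≤ #R⁺_{S₀}(W[2])` — the LOWER residual theta count at `2` — is the research
  heart: the residual `S₀`-imprimitive `+` Selmer set of `W[2] ≅ ρ̄_g` is AT LEAST as large as the `S₀`-imprimitive analytic
  `λ` of the CM partner predicts (the elliptic-unit / two-variable main-conjecture EQUALITY for `ψ` over `K` at the inert
  prime `2`, read residually; Kato-type divisibilities never give it). Spelled out below as the hypothesis `hLow` (= the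
  child crux 24195 with `=` replaced by `≤` in this direction; the filed two-sided item implies it trivially).
Main theorem `residualThetaMainConjectureAtTwo_of_lowerCount`: **Kλ⁺ BY NAME ⟸ (RLF) ∧ (RMC≥) ∧ K3 ∧ Kan⁺** — with K3 and
Kan⁺ the route's own cruxes (consumed by its deciding theorem anyway), the line's research content is (RLF) = 23110 and the
ONE-SIDED count (RMC≥). Skeleton `birth` v12 registers exactly these four stubs.

References: [Kobayashi2003] Thm. 1.2/1.3 and Conjecture p. 2; [Kato2004] Thm. 17.4 (the divisibility direction);
[GreenbergVatsal2000] Prop. 2.8 and (10); [PollackWeston2011MT] §3–4 (layer `λ`); [Matsuno2008] Lemma 2.4.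
-/

set_option autoImplicit false
-- D-0017: single-problem summit, so `Summit.BirchSwinnertonDyer.BirchSwinnertonDyer.…` repeats a namespace BY DESIGN.
set_option linter.dupNamespace false

noncomputable section

open scoped Classical

namespace Summit.BirchSwinnertonDyer.BirchSwinnertonDyer.Theorems.ResidualThetaLayer

/-- **Kato's half of the λ-part (Λλ≤).** From the route item K3 `SignedKatoDivisibilityUpToAtTwo` BY NAME
(`Char X⁺(W/ℚ_∞) = (g₁)` with `g₁·h = G'`, `ι G' = 2^{m'} ϖ ι L⁺_W`): for every torsion signed `+` dual datum `D` and every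
`G` with `ι G = 2^m ϖ ι L⁺_W`, `λ(X) ≤ λ(G)` — `λ(X) = λ(g₁)` (structure theorem, `lam_generator_eq_lambdaInvariant`),
`λ(g₁) ≤ λ(g₁ h)` (additivity), and `2^m·(g₁ h) = 2^{m'}·G` in `Λ` (`ι` injective) have the same `λ` (`λ` is blind to
`2`-power scaling). [cite: Kato2004, Thm. 17.4] [cite: Kobayashi2003, Thm. 1.3] -/
theorem lambdaInvariant_le_lam_of_signedKato
    (hKato : Summit.BirchSwinnertonDyer.BirchSwinnertonDyer.Theses.ResidualThetaTransportAtTwo.SignedKatoDivisibilityUpToAtTwo) :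
    ∀ (W : WeierstrassCurve ℚ) [W.IsElliptic] [W.IsGloballyMinimal], ¬ W.HasCM → W.analyticRank = 0 → Literature.NumberTheory.EllipticCurves.Rank1Residual.GoodSS W 2 → W.frobeniusTrace 2 = 0 → W.Δ < 0 → ∀ (κ : Literature.NumberTheory.EllipticCurves.ZpExtension ℚ 2) (γ : Field.absoluteGaloisGroup ℚ), κ.IsCyclotomic → κ.IsTopGenerator γ → Literature.NumberTheory.EllipticCurves.IsCyclotomicVariable 2 γ → ∀ [NeZero (W.conductorNorm ℤ)] (f : CuspForm (CongruenceSubgroup.Gamma0 (W.conductorNorm ℤ)) 2), Literature.NumberTheory.EllipticCurves.ModularForms.IsNewformOf W f → ∀ (ϖ : ℚ), (ϖ : ℝ) * W.realPeriodRat = Literature.NumberTheory.EllipticCurves.ModularForms.plusPeriod f → ∀ (Lplus Lminus : Literature.NumberTheory.EllipticCurves.IwasawaAlgebra 2), Summit.BirchSwinnertonDyer.Rank1Residual.Supersingular.IsPollackPair f 2 Lplus Lminus → ∀ (D : Literature.NumberTheory.EllipticCurves.Kobayashi2003.SignedSelmerDualData W κ γ 1) [Module.Finite (Literature.NumberTheory.EllipticCurves.IwasawaAlgebra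 2) D.X], Module.IsTorsion (Literature.NumberTheory.EllipticCurves.IwasawaAlgebra 2) D.X → D.mu = 0 → ∀ (G : Literature.NumberTheory.EllipticCurves.IwasawaAlgebra 2) (m : ℕ), Literature.NumberTheory.EllipticCurves.iwasawaToPowerSeries 2 G = PowerSeries.C ((2 : ℚ_[2]) ^ m * (ϖ : ℚ_[2])) * Literature.NumberTheory.EllipticCurves.iwasawaToPowerSeries 2 (Summit.BirchSwinnertonDyer.Rank1Residual.Supersingular.kobayashiL 1 Lplus Lminus) → Literature.NumberTheory.EllipticCurves.lambdaInvariant 2 D.X ≤ Summit.BirchSwinnertonDyer.Rank1Residual.X1.MuLambda.lam G := by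
  intro W _ _ hcm hr hss ha _hΔ κ γ hκ hγ hcv _ f hf ϖ hϖ Lplus Lminus hPP D _ hX _hμ G m hG
  obtain ⟨g₁, h, m', hchar, hgh⟩ := hKato W hcm hr hss ha κ γ hκ hγ hcv f hf ϖ hϖ Lplus Lminus hPP D
  have hL0 : PowerSeries.C (ϖ : ℚ_[2]) * Literature.NumberTheory.EllipticCurves.iwasawaToPowerSeries 2
      (Summit.BirchSwinnertonDyer.Rank1Residual.Supersingular.kobayashiL (1 : ℤˣ) Lplus Lminus) ≠ 0 :=
    Summit.BirchSwinnertonDyer.BirchSwinnertonDyer.Theorems.SignedTransportAtTwo.C_mul_iota_ne_zero hf hϖ hPP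
  have hgh0 : g₁ * h ≠ 0 := by
    intro h0
    apply Summit.BirchSwinnertonDyer.BirchSwinnertonDyer.Theorems.SignedTransportAtTwo.C_pow_mul_ne_zero m' hL0
    rw [← hgh, h0, map_zero]
  have hG0 : G ≠ 0 := by
    intro h0
    apply Summit.BirchSwinnertonDyer.BirchSwinnertonDyer.Theorems.SignedTransportAtTwo.C_pow_mul_ne_zero m hL0
    rw [← hG, h0, map_zero]
  have hg0 : g₁ ≠ 0 := left_ne_zero_of_mul hgh0
  have hh0 : h ≠ 0 := right_ne_zero_of_mul hgh0
  have hlamg : Summit.BirchSwinnertonDyer.Rank1Residual.X1.MuLambda.lam g₁ =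
      Literature.NumberTheory.EllipticCurves.lambdaInvariant 2 D.X :=
    Summit.BirchSwinnertonDyer.Rank1Residual.X1.ParitySqueeze.lam_generator_eq_lambdaInvariant D.X hX hg0 hchar
  -- `2^m · (g₁ h) = 2^{m'} · G` in `Λ`: both map to `2^{m+m'} ϖ L⁺` under the injective `ι`
  have hsc : (PowerSeries.C ((2 : ℤ_[2]) ^ m) : Literature.NumberTheory.EllipticCurves.IwasawaAlgebra 2) * (g₁ * h) =
      PowerSeries.C ((2 : ℤ_[2]) ^ m') * G := by
    apply Literature.NumberTheory.EllipticCurves.iwasawaToPowerSeries_injective 2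
    rw [map_mul (Literature.NumberTheory.EllipticCurves.iwasawaToPowerSeries 2) _ (g₁ * h), hgh,
      map_mul (Literature.NumberTheory.EllipticCurves.iwasawaToPowerSeries 2) _ G, hG]
    simp only [map_pow, map_ofNat, map_mul]
    ring
  have e1 : Summit.BirchSwinnertonDyer.Rank1Residual.X1.MuLambda.lam
      ((PowerSeries.C ((2 : ℤ_[2]) ^ m) : Literature.NumberTheory.EllipticCurves.IwasawaAlgebra 2) * (g₁ * h)) =
      Summit.BirchSwinnertonDyer.Rank1Residual.X1.MuLambda.lam (g₁ * h) :=
    Summit.BirchSwinnertonDyer.Rank1Residual.X1.ParitySqueeze.lam_C_pow_mul m hgh0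
  have e2 : Summit.BirchSwinnertonDyer.Rank1Residual.X1.MuLambda.lam
      ((PowerSeries.C ((2 : ℤ_[2]) ^ m') : Literature.NumberTheory.EllipticCurves.IwasawaAlgebra 2) * G) =
      Summit.BirchSwinnertonDyer.Rank1Residual.X1.MuLambda.lam G :=
    Summit.BirchSwinnertonDyer.Rank1Residual.X1.ParitySqueeze.lam_C_pow_mul m' hG0
  calc Literature.NumberTheory.EllipticCurves.lambdaInvariant 2 D.X
      = Summit.BirchSwinnertonDyer.Rank1Residual.X1.MuLambda.lam g₁ := hlamg.symm
    _ ≤ Summit.BirchSwinnertonDyer.Rank1Residual.X1.MuLambda.lam (g₁ * h) :=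
        Summit.BirchSwinnertonDyer.Rank1Residual.X1.MuLambda.lam_le_lam_mul hg0 hh0
    _ = Summit.BirchSwinnertonDyer.Rank1Residual.X1.MuLambda.lam G := by rw [← e1, hsc, e2]

/-- **Kλ⁺ BY NAME from (RLF), the LOWER residual theta count (RMC≥), K3 and Kan⁺.** For the crux's data (partner
`(M, g, ι)` at a plus period `Ω`, newform `f` of `W`, `ϖ`, Pollack pair of `f`, admissible odd `S₀`, torsion `μ = 0` datum `D`,
`G` with `ι G = 2^m ϖ ι L⁺_W`): take a cohomological plus period `Ω'` of `g` along `ι` (item 22892, landed), the landed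
`𝓞`-Pollack pair `(L⁺_g, L⁻_g)` of `g` at `Ω'` with the norm-λ `d` of `L⁻_g`; (RLF) gives the uniform `c` and
`#R⁺_{S₀}(W[2]) = 2^(λ(X) + Σ_W + c)`; (RMC≥) at this `c` gives `d + Σ_g ≤ λ(X) + Σ_W`; Kan⁺ at `Ω'` with the two landed layer
laws gives `λ(G) + Σ_W = d + Σ_g`; K3 gives `λ(X) ≤ λ(G)`; so `λ(X) = λ(G)`, and at any Kan⁺-layer for `Ω` both sides of Kλ⁺'s
defect identity vanish. (`d_v(W,2)` = Matsuno's `d̄_{W,ℓ}` at odd places: `sum_dMultiplicity_two_eq_sum_matsunoLocalTermAtTwo`.)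
[cite: GreenbergVatsal2000, Prop. 2.8 and (10)] [cite: PollackWeston2011MT, §3–4] [cite: Kato2004, Thm. 17.4] -/
theorem residualThetaMainConjectureAtTwo_of_lowerCount
    (hRLF : Summit.BirchSwinnertonDyer.BirchSwinnertonDyer.Theses.ResidualThetaTransportAtTwo.ResidualLambdaFormulaNegDiscAtTwo)
    (hLow : ∀ (W : WeierstrassCurve ℚ) [W.IsElliptic] [W.IsGloballyMinimal], ¬ W.HasCM → W.analyticRank = 0 → Literature.NumberTheory.EllipticCurves.Rank1Residual.GoodSS W 2 → W.frobeniusTrace 2 = 0 → W.Δ < 0 → ∀ (M : ℕ) [NeZero M] (g : CuspForm (CongruenceSubgroup.Gamma0 M) 2) (ι : Literature.NumberTheory.EllipticCurves.ModularForms.coeffField g →+* PadicAlgCl 2) (Ω : ℂ), Odd M → Literature.NumberTheory.EllipticCurves.ModularForms.IsNewform0 g → Literature.NumberTheory.Automorphic.IsCMForm (Literature.NumberTheory.EllipticCurves.ModularForms.liftToGamma1 M 2 g) → Literature.NumberTheory.EllipticCurves.ModularForms.cuspCoeff g 2 = 0 → Literature.NumberTheory.EllipticCurves.IsCohomologicalPlusPeriod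 g ι Ω → (∀ ℓ : ℕ, ℓ.Prime → ¬ ℓ ∣ 2 * M * W.conductorNorm ℤ → ‖Literature.NumberTheory.EllipticCurves.embCoeff g ι ℓ - (W.frobeniusTrace ℓ : PadicAlgCl 2)‖ < 1) → ∀ (κ : Literature.NumberTheory.EllipticCurves.ZpExtension ℚ 2) (γ : Field.absoluteGaloisGroup ℚ), κ.IsCyclotomic → κ.IsTopGenerator γ → Literature.NumberTheory.EllipticCurves.IsCyclotomicVariable 2 γ → ∀ (S₀ : Finset (IsDedekindDomain.HeightOneSpectrum (NumberField.RingOfIntegers ℚ))), (∀ v ∈ S₀, ((2 : ℕ) : NumberField.RingOfIntegers ℚ) ∉ v.asIdeal) → (∀ v : IsDedekindDomain.HeightOneSpectrum (NumberField.RingOfIntegers ℚ), ¬ W.HasGoodReductionAt v → v ∈ S₀) → (∀ v : IsDedekindDomain.HeightOneSpectrum (NumberField.RingOfIntegers ℚ), Rat.HeightOneSpectrum.natGenerator v ∣ M → v ∈ S₀) → ∀ (D : Literature.NumberTheory.EllipticCurves.Kobayashi2003.SignedSelmerDualData W κ γ 1) [Module.Finite (Literature.NumberTheory.EllipticCurves.IwasawaAlgebra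 2) D.X], Module.IsTorsion (Literature.NumberTheory.EllipticCurves.IwasawaAlgebra 2) D.X → D.mu = 0 → ∀ (Lp Lm : Literature.NumberTheory.EllipticCurves.IwasawaAlgebraO (Set.range ι)) (d : ℕ), Literature.NumberTheory.EllipticCurves.IsPollackPairK g ι Ω Lp Lm → (∀ k : ℕ, ‖PowerSeries.coeff k (Literature.NumberTheory.EllipticCurves.iwasawaOToPowerSeries (Set.range ι) Lm)‖ ≤ ‖PowerSeries.coeff d (Literature.NumberTheory.EllipticCurves.iwasawaOToPowerSeries (Set.range ι) Lm)‖) → (∀ k : ℕ, k < d → ‖PowerSeries.coeff k (Literature.NumberTheory.EllipticCurves.iwasawaOToPowerSeries (Set.range ι) Lm)‖ < ‖PowerSeries.coeff d (Literature.NumberTheory.EllipticCurves.iwasawaOToPowerSeries (Set.range ι) Lm)‖) → ∀ c : ℕ, (∀ (E : WeierstrassCurve ℚ) [E.IsElliptic] [E.IsGloballyMinimal], Literature.NumberTheory.EllipticCurves.Rank1Residual.GoodSS E 2 → E.frobeniusTrace 2 = 0 → E.Δ < 0 → (∀ v : IsDedekindDomain.HeightOneSpectrum (NumberField.RingOfIntegers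 ℚ), ¬ E.HasGoodReductionAt v → v ∈ S₀) → ∀ (D' : Literature.NumberTheory.EllipticCurves.Kobayashi2003.SignedSelmerDualData E κ γ 1) [Module.Finite (Literature.NumberTheory.EllipticCurves.IwasawaAlgebra 2) D'.X], Module.IsTorsion (Literature.NumberTheory.EllipticCurves.IwasawaAlgebra 2) D'.X → D'.mu = 0 → {x : Literature.NumberTheory.EllipticCurves.subgroupH1 κ.kerSubgroup ↥(AddSubgroup.torsionBy ↥(E.geomPrimaryTorsion 2) (2 : ℤ)) | x ∈ Literature.NumberTheory.EllipticCurves.GreenbergVatsal2000.unramifiedOutside κ.kerSubgroup ↥(AddSubgroup.torsionBy ↥(E.geomPrimaryTorsion 2) (2 : ℤ)) 2 (↑S₀ : Set (IsDedekindDomain.HeightOneSpectrum (NumberField.RingOfIntegers ℚ))) ∧ (∀ (w : NumberField.InfinitePlace ℚ) (σ : Field.absoluteGaloisGroup ℚ), Literature.NumberTheory.EllipticCurves.conjH1 κ.kerSubgroup ↥(AddSubgroup.torsionBy ↥(E.geomPrimaryTorsion 2) (2 : ℤ)) σ x ∈ Literature.NumberTheory.EllipticCurves.GreenbergSelmer.infKer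 κ.kerSubgroup ↥(AddSubgroup.torsionBy ↥(E.geomPrimaryTorsion 2) (2 : ℤ)) w) ∧ (∀ (v : IsDedekindDomain.HeightOneSpectrum (NumberField.RingOfIntegers ℚ)), ((2 : ℕ) : NumberField.RingOfIntegers ℚ) ∈ v.asIdeal → ∀ σ : Field.absoluteGaloisGroup ℚ, E.conjH1 2 κ.kerSubgroup σ (Literature.NumberTheory.EllipticCurves.GreenbergVatsal2000.pushH1 κ.kerSubgroup (AddSubgroup.torsionBy ↥(E.geomPrimaryTorsion 2) (2 : ℤ)).subtype (fun _ _ ↦ rfl) x) ∈ Literature.NumberTheory.EllipticCurves.Kobayashi2003.localKummerOverOfEmb E 2 κ.kerSubgroup (Literature.NumberTheory.EllipticCurves.closureEmb (K := ℚ) (v.adicCompletion ℚ)) (⨆ n : ℕ, Literature.NumberTheory.EllipticCurves.Kobayashi2003.signedLocalPoints κ (v.adicCompletion ℚ) E 1 n))}.ncard = 2 ^ (Literature.NumberTheory.EllipticCurves.lambdaInvariant 2 D'.X + ∑ v ∈ S₀, 2 ^ padicValNat 2 ((Rat.HeightOneSpectrum.natGenerator v ^ 2 - 1) / 8) * Literature.NumberTheory.EllipticCurves.GreenbergVatsal2000.dMultiplicity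 E 2 v + c)) → 2 ^ (d + (∑ v ∈ S₀, 2 ^ padicValNat 2 ((Rat.HeightOneSpectrum.natGenerator v ^ 2 - 1) / 8) * (if Rat.HeightOneSpectrum.natGenerator v ∣ M then (if ‖Literature.NumberTheory.EllipticCurves.embCoeff g ι (Rat.HeightOneSpectrum.natGenerator v) - 1‖ < 1 then 1 else 0) else (if ‖Literature.NumberTheory.EllipticCurves.embCoeff g ι (Rat.HeightOneSpectrum.natGenerator v)‖ < 1 then 2 else 0))) + c) ≤ {x : Literature.NumberTheory.EllipticCurves.subgroupH1 κ.kerSubgroup ↥(AddSubgroup.torsionBy ↥(W.geomPrimaryTorsion 2) (2 : ℤ)) | x ∈ Literature.NumberTheory.EllipticCurves.GreenbergVatsal2000.unramifiedOutside κ.kerSubgroup ↥(AddSubgroup.torsionBy ↥(W.geomPrimaryTorsion 2) (2 : ℤ)) 2 (↑S₀ : Set (IsDedekindDomain.HeightOneSpectrum (NumberField.RingOfIntegers ℚ))) ∧ (∀ (w : NumberField.InfinitePlace ℚ) (σ : Field.absoluteGaloisGroup ℚ), Literature.NumberTheory.EllipticCurves.conjH1 κ.kerSubgroup ↥(AddSubgroup.torsionBy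 ↥(W.geomPrimaryTorsion 2) (2 : ℤ)) σ x ∈ Literature.NumberTheory.EllipticCurves.GreenbergSelmer.infKer κ.kerSubgroup ↥(AddSubgroup.torsionBy ↥(W.geomPrimaryTorsion 2) (2 : ℤ)) w) ∧ (∀ (v : IsDedekindDomain.HeightOneSpectrum (NumberField.RingOfIntegers ℚ)), ((2 : ℕ) : NumberField.RingOfIntegers ℚ) ∈ v.asIdeal → ∀ σ : Field.absoluteGaloisGroup ℚ, W.conjH1 2 κ.kerSubgroup σ (Literature.NumberTheory.EllipticCurves.GreenbergVatsal2000.pushH1 κ.kerSubgroup (AddSubgroup.torsionBy ↥(W.geomPrimaryTorsion 2) (2 : ℤ)).subtype (fun _ _ ↦ rfl) x) ∈ Literature.NumberTheory.EllipticCurves.Kobayashi2003.localKummerOverOfEmb W 2 κ.kerSubgroup (Literature.NumberTheory.EllipticCurves.closureEmb (K := ℚ) (v.adicCompletion ℚ)) (⨆ n : ℕ, Literature.NumberTheory.EllipticCurves.Kobayashi2003.signedLocalPoints κ (v.adicCompletion ℚ) W 1 n))}.ncard)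
    (hKato : Summit.BirchSwinnertonDyer.BirchSwinnertonDyer.Theses.ResidualThetaTransportAtTwo.SignedKatoDivisibilityUpToAtTwo)
    (han : Summit.BirchSwinnertonDyer.BirchSwinnertonDyer.Theses.ResidualThetaTransportAtTwo.ThetaLayerLambdaCongruenceAtTwo) :
    Summit.BirchSwinnertonDyer.BirchSwinnertonDyer.Theses.ResidualThetaTransportAtTwo.ResidualThetaMainConjectureAtTwo := by
  intro W _ _ hcm hr hss ha hΔ M _ g ι Ω hodd hnew hcmg ha2 hΩ hcong κ γ hκ hγ hcv _ f hf ϖ hϖ Lplus Lminus hPP S₀ hS2 hSW hSM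
    D _ hX hμ G m hG
  -- it suffices to know `λ(X) = λ(G)`: then both sides of the defect identity vanish at every Kan⁺-layer for `Ω`
  suffices hMC : Literature.NumberTheory.EllipticCurves.lambdaInvariant 2 D.X =
      Summit.BirchSwinnertonDyer.Rank1Residual.X1.MuLambda.lam G by
    obtain ⟨n₀, hn₀⟩ := han W hcm hr hss ha hΔ M g ι Ω hodd hnew hcmg ha2 hΩ hcong f hf S₀ hS2 hSW hSM
    refine ⟨n₀, fun n hn he ↦ ?_⟩
    rw [hn₀ n hn he, hMC, sub_self, sub_self]
  -- Kato's half
  have hle : Literature.NumberTheory.EllipticCurves.lambdaInvariant 2 D.X ≤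
      Summit.BirchSwinnertonDyer.Rank1Residual.X1.MuLambda.lam G :=
    lambdaInvariant_le_lam_of_signedKato hKato W hcm hr hss ha hΔ κ γ hκ hγ hcv f hf ϖ hϖ Lplus Lminus hPP D hX hμ G m hG
  refine le_antisymm hle ?_
  -- the partner's half: a cohomological plus period `Ω'`, the `𝓞`-Pollack pair of `g` at `Ω'`, the norm-λ `d` of `L⁻_g`
  obtain ⟨Ω', hΩ'⟩ := CohomologicalPeriod.exists_isCohomologicalPlusPeriod hnew ι
  obtain ⟨Lp, Lm, hodd', heven'⟩ := stub_pollackCongruencesKAtTwo M g ι Ω' hodd hnew hcmg ha2 hΩ'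
  obtain ⟨hLp0, hLm0⟩ := stub_pollackNonvanishingKAtTwo M g ι Ω' hodd hnew hcmg ha2 hΩ' Lp Lm hodd' heven'
  have hPK : Literature.NumberTheory.EllipticCurves.IsPollackPairK g ι Ω' Lp Lm := ⟨hLp0, hLm0, hodd', heven'⟩
  obtain ⟨d, hd1, hd2⟩ := stub_normLambdaWitnessAtTwo M g ι hnew Lm hLm0
  -- (RLF): the uniform constant `c` and the count of `W`
  obtain ⟨c, hc⟩ := hRLF κ γ hκ hγ S₀ hS2
  have h1 := hc W hss ha hΔ hSW D hX hμ
  -- (RMC≥) at this `c`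
  have h2 := hLow W hcm hr hss ha hΔ M g ι Ω' hodd hnew hcmg ha2 hΩ' hcong κ γ hκ hγ hcv S₀ hS2 hSW hSM D hX hμ Lp Lm d hPK
    hd1 hd2 c (fun E _ _ hssE haE hΔE hSE D' _ hXE hμE ↦ hc E hssE haE hΔE hSE D' hXE hμE)
  rw [h1] at h2
  have h3 := (Nat.pow_le_pow_iff_right (by norm_num : 1 < 2)).mp h2
  have hS' : ∀ v ∈ S₀, Rat.HeightOneSpectrum.natGenerator v ≠ 2 := fun v hv ↦
    Summit.BirchSwinnertonDyer.Rank1Residual.X2.EulerFactorInvariants.natGenerator_ne_of_natCast_not_mem v (hS2 v hv)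
  rw [Literature.NumberTheory.EllipticCurves.sum_dMultiplicity_two_eq_sum_matsunoLocalTermAtTwo W S₀ hS'] at h3
  -- Kan⁺ at `Ω'` and the two landed layer laws at a common large even layer
  obtain ⟨n₁, hn₁⟩ := han W hcm hr hss ha hΔ M g ι Ω' hodd hnew hcmg ha2 hΩ'.isPlusPeriod hcong f hf S₀ hS2 hSW hSM
  obtain ⟨n₂, hn₂⟩ := stub_analyticLayerLawKAtTwo M g ι Ω' hnew Lp Lm d hPK hd1 hd2 S₀ hS2
  obtain ⟨n₃, hn₃⟩ := stub_analyticLayerLawAtTwo W hcm hr hss ha hΔ M g ι Ω hodd hnew hcmg ha2 hΩ hcong κ γ hκ hγ hcv f hf ϖ hϖ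
    Lplus Lminus hPP S₀ hS2 hSW hSM D G m hG
  have e1 := hn₁ (2 * max n₁ (max n₂ n₃)) (by omega) (even_two_mul _)
  have e2 := hn₂ (2 * max n₁ (max n₂ n₃)) (by omega) (even_two_mul _)
  have e3 := hn₃ (2 * max n₁ (max n₂ n₃)) (by omega) (even_two_mul _)
  rw [e1, e2] at e3
  omega

end Summit.BirchSwinnertonDyer.BirchSwinnertonDyer.Theorems.ResidualThetaLayer
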